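import Summits.CriticalPhenomena.SAWScalingLimit.Theorems.SAWLeftRightFKGFKGToTraversalBoundWitnessMonoEscapes
import Summits.CriticalPhenomena.SAWScalingLimit.Theorems.SAWLeftRightFKGFKGToTraversalBoundWitnessChildRank
import Summits.CriticalPhenomena.SAWScalingLimit.Theorems.SAWLeftRightFKGFKGToTraversalBoundDavenportSchinzel
import HarnessLib

/-!
# Witness glue T3b: the class-change bound along an outline arc

Crux `SAWLeftRightFKG.FKGToTraversalBound` (stmt-CriticalPhenomena-1878), line `slit-necklace`, lead
prover-line-stmt-CriticalPhenomena-1878-c5-0; registered stub `witness_classChanges` of the planar-witness glue, on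
top of the vocabulary `…WitnessCfg` (`FarTipCfg`), the rest-class file `…WitnessRestClass`
(`witness_restClass_connected`, `rest_notMem_Λ_of_mem_support`), the piece API of `…WitnessChildRank`
(`child_V_disjoint`, `child_V_walk₂`) and `…WitnessMonoEscapes` (`mono_mem_K`, `mono_interior_mem_Λ`,
`mono_interior_notMem_Sp`), the planar lemma `btour_abab` (…OutlineAbab) and the order-`2` Davenport–Schinzel bound
`card_changes_le_of_abab_free` (…DavenportSchinzel).

For a far-tip configuration `cfg`, the free component `F` of the first tip, and monotone positions `φ k`,
`k ≤ L`, inside one injective period of the wall-follower tour of `F`, the CONTACTS `bcontact (btour F e₀ (φ k))`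
are sorted into CLASSES: the rest class `Ω₀` (sites off `Λ`, spine sites, exterior chord vertices in the interior
of no non-degenerate far piece other than `cfg.i`), with LABEL `0`, and, for each non-degenerate far start
`i'' ≠ cfg.i`, the interior of its piece, with label `i'' + 1`.  The classes are pairwise disjoint `4`-connected
subsets of `ℤ² ∖ F` (`classes_cls_disjoint`, `classes_cls_conn`, `classes_cls_notMem`) and cover the contacts
(`classes_mem_cls_lab`), so by `btour_abab` the sequence of labels along the arc is `abab`-free, and by
Davenport–Schinzel it changes value at most `2 (nfar + 1) - 2` times (`witness_classChanges`).  The class family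
`cls : ℕ → Set ℤ²` and the label `lab : ℤ² → ℕ` are introduced existentially (`classes_exists_cls`,
`classes_exists_lab`); no definition is added.

All statements folklore; no literature fact; nothing restates the crux.
-/

noncomputable section

open Set
open Literature.Probability.LatticeModels
open Literature.Probability.RandomPlanarGeometry
open Literature.Probability.RandomPlanarGeometry.SAW
open Summit.CriticalPhenomena.SAWScalingLimit.Theorems.FKGToTraversalBound.Negative (dom)

namespace Summit.CriticalPhenomena.SAWScalingLimit.Theorems.FKGToTraversalBound.SlitNecklace

variable {D : DobrushinDomain}

/-! ### The class family and the label -/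

/-- **The class family.**  A family `cls : ℕ → Set ℤ²` with `cls 0 =` the rest class `Ω₀` and `cls (i'' + 1) =`
the interior of the piece of `i''` if `i''` is a non-degenerate far start other than `cfg.i` (empty otherwise).
[folklore] -/
private theorem classes_exists_cls (cfg : FarTipCfg D) : ∃ cls : ℕ → Set (Site 2),
    (∀ z, z ∈ cls 0 ↔ (z ∉ cfg.Λ ∨ z ∈ cfg.Sp ∨
      (z ∈ cfg.Ext ∧ ∀ i'' ∈ cfg.farStarts, cfg.NonDeg i'' → i'' ≠ cfg.i → z ∉ cfg.V i'' (cfg.pend i'')))) ∧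
    ∀ i'' z, z ∈ cls (i'' + 1) ↔
      (i'' ∈ cfg.farStarts ∧ cfg.NonDeg i'' ∧ i'' ≠ cfg.i ∧ z ∈ cfg.V i'' (cfg.pend i'')) :=
  ⟨fun l => Nat.rec (motive := fun _ => Set (Site 2))
      {z | z ∉ cfg.Λ ∨ z ∈ cfg.Sp ∨
        (z ∈ cfg.Ext ∧ ∀ i'' ∈ cfg.farStarts, cfg.NonDeg i'' → i'' ≠ cfg.i → z ∉ cfg.V i'' (cfg.pend i''))}
      (fun i'' _ => {z | i'' ∈ cfg.farStarts ∧ cfg.NonDeg i'' ∧ i'' ≠ cfg.i ∧ z ∈ cfg.V i'' (cfg.pend i'')}) l,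
    fun _ => Iff.rfl, fun _ _ => Iff.rfl⟩

/-- **The label.**  A function `lab : ℤ² → ℕ` with `lab z = i'' + 1` for a non-degenerate far start `i'' ≠ cfg.i`
whose piece interior contains `z` (there is at most one), and `lab z = 0` if there is none. [folklore] -/
private theorem classes_exists_lab (cfg : FarTipCfg D) : ∃ lab : Site 2 → ℕ, ∀ z,
    (lab z = 0 ∧ ∀ i'', ¬ (i'' ∈ cfg.farStarts ∧ cfg.NonDeg i'' ∧ i'' ≠ cfg.i ∧ z ∈ cfg.V i'' (cfg.pend i''))) ∨
    ∃ i'', (i'' ∈ cfg.farStarts ∧ cfg.NonDeg i'' ∧ i'' ≠ cfg.i ∧ z ∈ cfg.V i'' (cfg.pend i'')) ∧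
      lab z = i'' + 1 := by
  classical
  refine ⟨fun z => if h : ∃ i'', i'' ∈ cfg.farStarts ∧ cfg.NonDeg i'' ∧ i'' ≠ cfg.i ∧ z ∈ cfg.V i'' (cfg.pend i'')
    then h.choose + 1 else 0, fun z => ?_⟩
  by_cases h : ∃ i'', i'' ∈ cfg.farStarts ∧ cfg.NonDeg i'' ∧ i'' ≠ cfg.i ∧ z ∈ cfg.V i'' (cfg.pend i'')
  · beta_reduce
    rw [dif_pos h]
    exact Or.inr ⟨h.choose, h.choose_spec, rfl⟩
  · beta_reduce
    rw [dif_neg h]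
    exact Or.inl ⟨rfl, fun i'' hz => h ⟨i'', hz⟩⟩

/-! ### Disjointness, connectedness, avoidance of the free set, cover -/

/-- A site of the rest class is an interior vertex of no non-degenerate far piece `≠ cfg.i`: such vertices are in
`Λ` (`mono_interior_mem_Λ`) and off the spine, and the piece condition of the rest class excludes them.
[folklore] -/
private theorem classes_rest_piece (cfg : FarTipCfg D) {z : Site 2} {i'' : ℕ}
    (hr : z ∉ cfg.Λ ∨ z ∈ cfg.Sp ∨
      (z ∈ cfg.Ext ∧ ∀ i'' ∈ cfg.farStarts, cfg.NonDeg i'' → i'' ≠ cfg.i → z ∉ cfg.V i'' (cfg.pend i'')))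
    (hfs : i'' ∈ cfg.farStarts) (hnd : cfg.NonDeg i'') (hne : i'' ≠ cfg.i) (hV : z ∈ cfg.V i'' (cfg.pend i'')) :
    False := by
  obtain ⟨m, hm₁, hm₂, rfl⟩ := hV
  rcases hr with h | h | h
  · exact h (mono_interior_mem_Λ cfg hfs hnd hm₁ hm₂)
  · exact mono_interior_notMem_Sp cfg hfs hm₁ hm₂ h
  · exact h.2 i'' hfs hnd hne ⟨m, hm₁, hm₂, rfl⟩

section Cls

variable (cfg : FarTipCfg D) {cls : ℕ → Set (Site 2)}
  (hc0 : ∀ z, z ∈ cls 0 ↔ (z ∉ cfg.Λ ∨ z ∈ cfg.Sp ∨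
    (z ∈ cfg.Ext ∧ ∀ i'' ∈ cfg.farStarts, cfg.NonDeg i'' → i'' ≠ cfg.i → z ∉ cfg.V i'' (cfg.pend i''))))
  (hcS : ∀ i'' z, z ∈ cls (i'' + 1) ↔
    (i'' ∈ cfg.farStarts ∧ cfg.NonDeg i'' ∧ i'' ≠ cfg.i ∧ z ∈ cfg.V i'' (cfg.pend i'')))
include hc0 hcS

/-- **Distinct labels have disjoint classes** (rest versus piece: `classes_rest_piece`; two pieces:
`child_V_disjoint`). [folklore] -/
private theorem classes_cls_disjoint {l₁ l₂ : ℕ} (hne : l₁ ≠ l₂) : Disjoint (cls l₁) (cls l₂) := by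
  rw [Set.disjoint_left]
  intro z h₁ h₂
  cases l₁ with
  | zero =>
    cases l₂ with
    | zero => exact hne rfl
    | succ i₂ =>
      obtain ⟨hfs, hnd, hne₂, hV⟩ := (hcS i₂ z).1 h₂
      exact classes_rest_piece cfg ((hc0 z).1 h₁) hfs hnd hne₂ hV
  | succ i₁ =>
    cases l₂ with
    | zero =>
      obtain ⟨hfs, hnd, hne₁, hV⟩ := (hcS i₁ z).1 h₁
      exact classes_rest_piece cfg ((hc0 z).1 h₂) hfs hnd hne₁ hV
    | succ i₂ =>
      have hi : i₁ ≠ i₂ := fun h => hne (by rw [h])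
      obtain ⟨hfs₁, -, -, hV₁⟩ := (hcS i₁ z).1 h₁
      obtain ⟨hfs₂, -, -, hV₂⟩ := (hcS i₂ z).1 h₂
      exact Set.disjoint_left.1 (cfg.child_V_disjoint (cfg.child_isPiece_of_mem_farStarts hfs₁)
        (cfg.child_isPiece_of_mem_farStarts hfs₂) hi) hV₁ hV₂

/-- **Every class is `4`-connected** (the rest class by `witness_restClass_connected`, a piece class along the
chord by `child_V_walk₂`). [folklore] -/
private theorem classes_cls_conn (l : ℕ) :
    ∀ x ∈ cls l, ∀ x' ∈ cls l, ∃ p : (zdGraph 2).Walk x x', ∀ z ∈ p.support, z ∈ cls l := by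
  intro x hx x' hx'
  cases l with
  | zero =>
    obtain ⟨w, hw⟩ := witness_restClass_connected cfg x x' ((hc0 x).1 hx) ((hc0 x').1 hx')
    exact ⟨w, fun z hz => (hc0 z).2 (hw z hz)⟩
  | succ i'' =>
    obtain ⟨hfs, hnd, hne, hxV⟩ := (hcS i'' x).1 hx
    obtain ⟨-, -, -, hx'V⟩ := (hcS i'' x').1 hx'
    obtain ⟨w, hw⟩ := cfg.child_V_walk₂ (cfg.child_idx_of_mem_farStarts hfs).2 hxV hx'V
    exact ⟨w, fun z hz => (hcS i'' z).2 ⟨hfs, hnd, hne, hw z hz⟩⟩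

/-- **Every class avoids a site set `F ⊆ Λ ∖ K`** (rest sites are off `Λ` or in `Sp ∪ Ext = K`; interior
vertices of the piece of a far start `≠ cfg.i` are in `K` by `mono_mem_K`). [folklore] -/
private theorem classes_cls_notMem (F : Finset (Site 2)) (hFΛ : ∀ x ∈ F, x ∈ cfg.Λ) (hFK : ∀ x ∈ F, x ∉ cfg.K)
    (l : ℕ) : ∀ x ∈ cls l, x ∉ (↑F : Set (Site 2)) := by
  intro x hx hxF
  rw [Finset.mem_coe] at hxF
  cases l with
  | zero =>
    rcases (hc0 x).1 hx with h | h | h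
    · exact h (hFΛ x hxF)
    · exact hFK x hxF (by rw [FarTipCfg.K_def, Finset.mem_union]; exact Or.inl h)
    · exact hFK x hxF (by rw [FarTipCfg.K_def, Finset.mem_union]; exact Or.inr h.1)
  | succ i'' =>
    obtain ⟨hfs, -, hne, m, hm₁, hm₂, rfl⟩ := (hcS i'' x).1 hx
    exact hFK _ hxF (mono_mem_K cfg hfs hne hm₁.le hm₂.le)

variable {lab : Site 2 → ℕ}
  (hlab : ∀ z, (lab z = 0 ∧ ∀ i'', ¬ (i'' ∈ cfg.farStarts ∧ cfg.NonDeg i'' ∧ i'' ≠ cfg.i ∧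
      z ∈ cfg.V i'' (cfg.pend i''))) ∨
    ∃ i'', (i'' ∈ cfg.farStarts ∧ cfg.NonDeg i'' ∧ i'' ≠ cfg.i ∧ z ∈ cfg.V i'' (cfg.pend i'')) ∧ lab z = i'' + 1)
include hlab

/-- **Cover**: a site of `K ∪ C.support` lies in the class of its label (`C.support` is off `Λ`,
`rest_notMem_Λ_of_mem_support`; `K = Sp ∪ Ext`). [folklore] -/
private theorem classes_mem_cls_lab {z : Site 2} (hz : z ∈ cfg.K ∨ z ∈ cfg.C.support) : z ∈ cls (lab z) := by
  rcases hlab z with ⟨h0, hno⟩ | ⟨i'', hzi, hl⟩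
  · rw [h0, hc0]
    rcases hz with hK | hC
    · rw [FarTipCfg.K_def, Finset.mem_union] at hK
      rcases hK with hSp | hE
      · exact Or.inr (Or.inl hSp)
      · exact Or.inr (Or.inr ⟨hE, fun i'' hfs hnd hne hV => hno i'' ⟨hfs, hnd, hne, hV⟩⟩)
    · exact Or.inl (rest_notMem_Λ_of_mem_support cfg hC)
  · rw [hl, hcS]
    exact hzi

/-- **Same label, same class**: two sites of `K ∪ C.support` with equal labels are both in the rest class or both
in the interior of the piece of one non-degenerate far start `≠ cfg.i`. [folklore] -/
private theorem classes_sameCls {z z' : Site 2} (hz : z ∈ cfg.K ∨ z ∈ cfg.C.support)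
    (hz' : z' ∈ cfg.K ∨ z' ∈ cfg.C.support) (heq : lab z = lab z') :
    ((z ∉ cfg.Λ ∨ z ∈ cfg.Sp ∨
        (z ∈ cfg.Ext ∧ ∀ i'' ∈ cfg.farStarts, cfg.NonDeg i'' → i'' ≠ cfg.i → z ∉ cfg.V i'' (cfg.pend i''))) ∧
      (z' ∉ cfg.Λ ∨ z' ∈ cfg.Sp ∨
        (z' ∈ cfg.Ext ∧ ∀ i'' ∈ cfg.farStarts, cfg.NonDeg i'' → i'' ≠ cfg.i → z' ∉ cfg.V i'' (cfg.pend i'')))) ∨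
    (∃ i'' ∈ cfg.farStarts, cfg.NonDeg i'' ∧ i'' ≠ cfg.i ∧ z ∈ cfg.V i'' (cfg.pend i'') ∧
      z' ∈ cfg.V i'' (cfg.pend i'')) := by
  have h₁ := classes_mem_cls_lab cfg hc0 hcS hlab hz
  have h₂ := classes_mem_cls_lab cfg hc0 hcS hlab hz'
  rw [heq] at h₁
  rcases hlab z' with ⟨h0, -⟩ | ⟨i'', -, hl⟩
  · rw [h0, hc0] at h₁ h₂
    exact Or.inl ⟨h₁, h₂⟩
  · rw [hl, hcS] at h₁ h₂
    obtain ⟨hfs, hnd, hne, hV₁⟩ := h₁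
    exact Or.inr ⟨i'', hfs, hnd, hne, hV₁, h₂.2.2.2⟩

end Cls

/-! ### The registered stub -/

/-- **Witness glue T3b — the class-change bound.**  Along monotone positions `φ k`, `k ≤ L`, inside one injective
period of the wall-follower tour of the free component `F`, the contacts change class (rest class `Ω₀` / interior
of the piece of a non-degenerate far start `≠ cfg.i`) at most `2 (nfar + 1) - 2` times: the classes are pairwise
disjoint `4`-connected subsets of `ℤ² ∖ F`, so the label sequence is `abab`-free by `btour_abab`, and the
Davenport–Schinzel bound of order `2` (`card_changes_le_of_abab_free`) over the `≤ nfar + 1` labels applies.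
[folklore] -/
theorem witness_classChanges : ∀ {D : DobrushinDomain} (cfg : FarTipCfg D) (F : Finset (Site 2)) (e₀ : Site 2 × ODir) (N m n L : ℕ) (φ : ℕ → ℕ) (s : Finset ℕ), (∀ x, x ∈ F ↔ x ∈ cfg.Fset) → (∀ x ∈ F, x ∈ cfg.Λ) → (∀ x ∈ F, x ∉ cfg.K) → (∀ x ∈ F, ∀ x' ∈ F, ∃ w : (zdGraph 2).Walk x x', ∀ z ∈ w.support, z ∈ F) → (∀ x ∈ F, ∀ x' : Site 2, x' ∉ F → (zdGraph 2).Adj x x' → x' ∈ cfg.K ∨ x' ∈ cfg.C.support) → IsBEdge (↑F : Set (Site 2)) e₀ → 0 < N → btour (↑F : Set (Site 2)) e₀ N = e₀ → (∀ j j', j < N → j' < N → btour (↑F : Set (Site 2)) e₀ j = btour (↑F : Set (Site 2)) e₀ j' → j = j') → m ≤ n → n < m + N → Monotone φ → (∀ k, k ≤ L → m ≤ φ k ∧ φ k ≤ n) → (∀ k ∈ s, k < L ∧ ¬ (((bcontact (btour (↑F : Set (Site 2)) e₀ (φ k)) ∉ cfg.Λ ∨ bcontact (btour (↑F : Set (Site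 2)) e₀ (φ k)) ∈ cfg.Sp ∨ (bcontact (btour (↑F : Set (Site 2)) e₀ (φ k)) ∈ cfg.Ext ∧ ∀ i'' ∈ cfg.farStarts, cfg.NonDeg i'' → i'' ≠ cfg.i → bcontact (btour (↑F : Set (Site 2)) e₀ (φ k)) ∉ cfg.V i'' (cfg.pend i''))) ∧ (bcontact (btour (↑F : Set (Site 2)) e₀ (φ (k + 1))) ∉ cfg.Λ ∨ bcontact (btour (↑F : Set (Site 2)) e₀ (φ (k + 1))) ∈ cfg.Sp ∨ (bcontact (btour (↑F : Set (Site 2)) e₀ (φ (k + 1))) ∈ cfg.Ext ∧ ∀ i'' ∈ cfg.farStarts, cfg.NonDeg i'' → i'' ≠ cfg.i → bcontact (btour (↑F : Set (Site 2)) e₀ (φ (k + 1))) ∉ cfg.V i'' (cfg.pend i'')))) ∨ (∃ i'' ∈ cfg.farStarts, cfg.NonDeg i'' ∧ i'' ≠ cfg.i ∧ bcontact (btour (↑F : Set (Site 2)) e₀ (φ k)) ∈ cfg.V i'' (cfg.pend i'') ∧ bcontact (btour (↑F : Set (Site 2)) e₀ (φ (k + 1))) ∈ cfg.V i'' (cfg.pend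 i'')))) → s.card + 2 ≤ 2 * (cfg.nfar + 1) := by
  intro D cfg F e₀ N m n L φ s _ hFΛ hFK hFconn hFnbr he₀ _ hper hinj _ hnN hφ hφr hs
  -- the class family, the label, and the label sequence of the contacts
  obtain ⟨cls, hc0, hcS⟩ := classes_exists_cls cfg
  obtain ⟨lab, hlab⟩ := classes_exists_lab cfg
  obtain ⟨f, hf⟩ : ∃ f : ℕ → ℕ, ∀ k, f k = lab (bcontact (btour (↑F : Set (Site 2)) e₀ (φ k))) :=
    ⟨_, fun _ => rfl⟩
  -- every contact is a site of `K ∪ C.support`, hence lies in the class of its label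
  have hcov : ∀ k, bcontact (btour (↑F : Set (Site 2)) e₀ (φ k)) ∈ cfg.K ∨
      bcontact (btour (↑F : Set (Site 2)) e₀ (φ k)) ∈ cfg.C.support := by
    intro k
    obtain ⟨hs₁, hc₁, hadj⟩ := bcontact_spec (↑F : Set (Site 2)) (btour_isBEdge _ he₀ (φ k))
    exact hFnbr _ hs₁ _ hc₁ hadj
  have hmem : ∀ k, bcontact (btour (↑F : Set (Site 2)) e₀ (φ k)) ∈ cls (f k) := by
    intro k
    rw [hf]
    exact classes_mem_cls_lab cfg hc0 hcS hlab (hcov k)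
  -- the class changes contain `s`
  have hsub : s ⊆ (Finset.range L).filter (fun k => f k ≠ f (k + 1)) := by
    intro k hk
    obtain ⟨hkL, hncls⟩ := hs k hk
    refine Finset.mem_filter.2 ⟨Finset.mem_range.2 hkL, fun heq => hncls ?_⟩
    rw [hf, hf] at heq
    exact classes_sameCls cfg hc0 hcS hlab (hcov k) (hcov (k + 1)) heq
  -- the labels take at most `nfar + 1` values
  have hfin : cfg.farStarts.Finite :=
    (Finset.range (cfg.γ.length + 1)).finite_toSet.subset fun x hx => by
      have := cfg.child_idx_of_mem_farStarts hx
      simp only [Finset.coe_range, Set.mem_Iio]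
      omega
  have hval : ∀ k, k ≤ L → f k ∈ insert 0 (hfin.toFinset.image (· + 1)) := by
    intro k _
    rw [hf]
    rcases hlab (bcontact (btour (↑F : Set (Site 2)) e₀ (φ k))) with ⟨h0, -⟩ | ⟨i'', hzi, hl⟩
    · rw [h0]
      exact Finset.mem_insert_self _ _
    · rw [hl]
      exact Finset.mem_insert_of_mem (Finset.mem_image.2 ⟨i'', hfin.mem_toFinset.2 hzi.1, rfl⟩)
  have hcard : (insert 0 (hfin.toFinset.image (· + 1))).card ≤ cfg.nfar + 1 := by
    have h : cfg.nfar = hfin.toFinset.card := Set.ncard_eq_toFinset_card _ hfin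
    rw [h]
    exact (Finset.card_insert_le _ _).trans (Nat.succ_le_succ Finset.card_image_le)
  -- the label sequence is `abab`-free (planarity: `btour_abab`)
  have hfree : ¬ ∃ a b c d : ℕ, a < b ∧ b < c ∧ c < d ∧ d ≤ L ∧ f a = f c ∧ f b = f d ∧ f a ≠ f b := by
    rintro ⟨a, b, c, d, hab, hbc, hcd, hdL, hac, hbd, hne⟩
    have hlt : ∀ k k', k < k' → f k ≠ f k' → φ k < φ k' := by
      intro k k' hkk' hfk
      refine lt_of_le_of_ne (hφ hkk'.le) fun heq => hfk ?_
      rw [hf, hf, heq]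
    have h12 : φ a < φ b := hlt a b hab hne
    have h23 : φ b < φ c := hlt b c hbc fun h => hne (hac.trans h.symm)
    have h34 : φ c < φ d := hlt c d hcd fun h => hne (hac.trans (h.trans hbd.symm))
    have h41 : φ d < φ a + N := by
      have h1 := (hφr d hdL).2
      have h2 := (hφr a (by omega)).1
      omega
    have hc : bcontact (btour (↑F : Set (Site 2)) e₀ (φ c)) ∈ cls (f a) := by
      rw [hac]; exact hmem c
    have hd : bcontact (btour (↑F : Set (Site 2)) e₀ (φ d)) ∈ cls (f b) := by
      rw [hbd]; exact hmem d
    exact btour_abab F (cls (f a)) (cls (f b)) e₀ (φ a) (φ b) (φ c) (φ d) N he₀ hFconn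
      (classes_cls_notMem cfg hc0 hcS F hFΛ hFK (f a)) (classes_cls_notMem cfg hc0 hcS F hFΛ hFK (f b))
      (classes_cls_disjoint cfg hc0 hcS hne) (classes_cls_conn cfg hc0 hcS (f a))
      (classes_cls_conn cfg hc0 hcS (f b)) h12 h23 h34 h41 hper hinj (hmem a) (hmem b) hc hd
  -- Davenport–Schinzel
  have hDS := card_changes_le_of_abab_free f L _ hval hfree
  have h1 := Finset.card_le_card hsub
  omega

end Summit.CriticalPhenomena.SAWScalingLimit.Theorems.FKGToTraversalBound.SlitNecklace

end
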